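import Summits.HodgeConjecture.HodgeConjecture.Theorems.F0P2nFrobeniusFunctional                    -- ★ K1b (p01): `isConstituentOf_mk_cmPrincipalSeries_xi_of_functional`
import Summits.HodgeConjecture.HodgeConjecture.Theorems.F0P2oK1wOfWeylConj                          -- ★ K1w consumer (p02): `stubK1w_of_weylConj (hW)`
import Literature.NumberTheory.Rogawski1990.U3PrincipalSeriesWeylConjugate                            -- ★ K1w LETTER (typ-T7a): `cmPrincipalSeries_isConstituentOf_weylConj`
import Summits.HodgeConjecture.HodgeConjecture.Theorems.F0P2oXThetaOwnClass                          -- ★ K1c closer (p05): `stubK1c_holds`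
import Summits.HodgeConjecture.HodgeConjecture.Theorems.F0P2oBorelEigenfunctionalOfJacquetModule     -- ★ N3 ⟹ N3ᵟ (B-p18 (g28)): `thetaType_nonsplit_borelEigenfunctional_of_jacquetModule`
import Summits.HodgeConjecture.HodgeConjecture.Theorems.F0P2oK1occ                                   -- ★ K1occ (p01): `k1occ_of_u1ThetaDichotomy (hU1)`
import Literature.NumberTheory.GelbartRogawski1991.U1ThetaDichotomy                                    -- ★ U1 LETTER (typ-T7b): `u1ThetaDichotomy_nonsplit`
import Literature.NumberTheory.GelbartRogawski1991.ThetaTypeNonsplitJacquetModule                      -- ★ N3 LETTER (typ-T7a): `thetaType_nonsplit_jacquetModule`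
import Summits.HodgeConjecture.HodgeConjecture.Theorems.F0P2oK1aWOfLetters                           -- ★ K1aʷ closer (B-p18 (g28)): `stubK1aW_of_letters (hN3) (hU1)`
import HarnessLib

/-!
# Crux `H413`, programme P2, pay-down line `F0_P2GR91NJacquet` — THE PARENT-FOLD COMPOSITION: K1 `StubThetaInPS` FROM THE PRINT LETTERS {N3, K1w, U1}

Cell hodgecm-mathlib (D-0151), FLOOR 0, crux H413 = stmt-HodgeConjecture-24833; parent line `Cruxes/H413/Lines/F0_P2GR91NJacquet.lean` (v1.1 005aff4b9c8c,
registered stub K1 `stub_thetaType_in_principalSeries : StubThetaInPS` :87–101), K1 sub-line `Cruxes/H413/Lines/F0_P2GR91NJacquetK1.lean` (v3a 368644d96141),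
lead B-p18 (g28).  Desk routing (F0P2-plan (g7) 15:10:23Z): the parent fold is NOT a `Lines → Lines` import but THIS `Theorems/` composition over the ★ closers,
after which the parent edition v1.2 reads `stub_thetaType_in_principalSeries := stubThetaInPS_of_letters stub_N3_letter stub_K1w_letter stub_U1_letter`.
The statement below is the body of `StubThetaInPS` VERBATIM with the parent's Lines-local `CenterCharSpec L μ χf ε v ψθ` spelled as its ★ Literature twin
`IsThetaCenterChar L μ χf ε v ψθ` (★ `ThetaDichotomyVocabulary`; token-identical body, so the parent fold type-checks by δ-unfolding).
CONDITIONAL on exactly three print letters, taken BY NAME: `hN3` [GelbartRogawski1991 §3.2 (3.2.1)–(3.2.2); Kudla1986 Thm. 2.8] (★ p826177),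
`hW` [Rogawski1990 §12.2 p. 174 L3–5; BernsteinZelevinsky1977 Thm. 2.9] (★ p826332), `hU1` [HarrisKudlaSweet1996 Cor. 4.4; Rogawski1992 Prop. 3.4] (★ p826953 ∕ p827180).
HC_CM is proved only modulo the printed citations until rung 0 closes; this file proves no letter — it composes.

## The composition (= the sub-line's head `k1_of_stubs`, by name)
K1aʷ «Jacquet functional for χθʷ» ⟸ N3ᵟ (★ `thetaType_nonsplit_borelEigenfunctional_of_jacquetModule hN3`, over ★ K1m) + occurrence (★ `k1occ_of_u1ThetaDichotomy hU1`) —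
the closer ★ `F0P2oK1aWOfLetters.stubK1aW_of_letters hN3 hU1` (B-p18 (g28)); K1w «Weyl symmetry» ⟸ ★ `stubK1w_of_weylConj hW`; K1c «own class» = ★ `stubK1c_holds` (letter-free); K1b Frobenius ★.
-/

set_option autoImplicit false
-- the mandated namespace has the single-problem summit's repeated segment (`HodgeConjecture.HodgeConjecture`)
set_option linter.dupNamespace false

noncomputable section

open NumberField IsDedekindDomain MeasureTheory
open scoped Matrix

open Literature.NumberTheory Literature.NumberTheory.Automorphic Literature.NumberTheory.Automorphic.UnitaryGroup
open Literature.NumberTheory.Automorphic.IdeleClassGroup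
open Literature.NumberTheory.Automorphic.Liu2021 Literature.NumberTheory.Automorphic.Liu2021.Def411WeilCarriers
open Literature.NumberTheory.GaloisRepresentations
open Literature.NumberTheory.Rogawski1990
open Literature.NumberTheory.GelbartRogawski1991

namespace Summit.HodgeConjecture.HodgeConjecture.Cruxes.H413.F0P2oThetaInPSOfLetters

set_option synthInstance.maxHeartbeats 400000 in
set_option maxHeartbeats 16000000 in
/-- **K1 `StubThetaInPS` (parent `Cruxes/H413/Lines/F0_P2GR91NJacquet.lean` :87–101 VERBATIM, `CenterCharSpec` ↦ its token-identical ★ twin `IsThetaCenterChar`)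
FROM THE THREE PRINT LETTERS N3, K1w, U1.**  For a CM frame `(L, H, e₁, dV, g)`, conjugate-symplectic `μ`, continuous unitary `χ_f`, a NON-SPLIT `v` and a form
congruence `ᵗT̄ H_v T = a·Φ₃`: some line class `ε`, some `ψθ` with `IsThetaCenterChar`, and some constituent `x₀` of `i_G(χθ)`, `χθ = cmXiTorusChar L v μ_v ψθ⁻¹ ψθ`,
whose transport to `U(H)(L⁺_v)` is the theta type `X_v(μ, ε, χ_f) ∘ κ_v⁻¹` (★ `ThetaTypeAtCM`).  Proof = the sub-line head: K1aʷ (N3ᵟ ⟸ `hN3` by ★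
`thetaType_nonsplit_borelEigenfunctional_of_jacquetModule`; occurrence ⟸ `hU1` by ★ `k1occ_of_u1ThetaDichotomy`; closer ★ `F0P2oK1aWOfLetters.stubK1aW_of_letters`) gives `(ε, ψθ, ℓ)`;
K1c ★ `stubK1c_holds` gives irreducibility, smoothness and `ThetaTypeAtCM` of the own class; K1b ★ Frobenius puts the class in `i_G(χθʷ)`; K1w ★
`stubK1w_of_weylConj hW` moves it to `i_G(χθ)`.
[cite: GelbartRogawski1991, §5.1 (5.1.1) p. 465, Lem. 5.1.2 pp. 465–466; §3.2 (3.2.1)–(3.2.2) p. 457] [cite: Rogawski1990, §12.2 (2) p. 174] [cite: Kudla1986, Thm. 2.8]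
[cite: HarrisKudlaSweet1996, Cor. 4.4] -/
theorem stubThetaInPS_of_letters
    (hN3 : Literature.NumberTheory.GelbartRogawski1991.thetaType_nonsplit_jacquetModule)
    (hW : Literature.NumberTheory.Rogawski1990.cmPrincipalSeries_isConstituentOf_weylConj)
    (hU1 : Literature.NumberTheory.GelbartRogawski1991.u1ThetaDichotomy_nonsplit) :
    ∀ (L : Type) [Field L] [NumberField L] [IsCMField L] (H : Matrix (Fin 3) (Fin 3) L) (hH : (H.map (cmConjRingHom L))ᵀ = H) (hHd : IsUnit H.det)
    {n' : ℕ} (e₁ : Fin 3 × Fin 1 ≃ Fin n') (dV : Fin 3 → L) (hdV : ∀ i, IsCMField.complexConj L (dV i) = dV i) (hdV0 : ∀ i, dV i ≠ 0) (g : GL (Fin 3) L)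
    (hg : ((g : Matrix (Fin 3) (Fin 3) L).map (cmConjRingHom L))ᵀ * H * (g : Matrix (Fin 3) (Fin 3) L) = Matrix.diagonal dV),
    ∀ (μ : Literature.NumberTheory.Automorphic.IdeleClassGroup L →ₜ* Circle) (hμ : IsConjugateSymplectic L μ)
      (χf : UnitaryGroup.finAdelicOne (↥(maximalRealSubfield L)) L (IsCMField.complexConj L) →* ℂˣ),
      Continuous χf → (∀ z, ‖((χf z : ℂˣ) : ℂ)‖ = 1) →
      ∀ (v : HeightOneSpectrum (𝓞 ↥(maximalRealSubfield L))),
        (∀ w : PlacesOver L v, IsCMField.complexConj L • w.1 = w.1) →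
        ∀ (T : GL (Fin 3) (UnitaryGroup.LocalRing L v)) (a : UnitaryGroup.LocalRing L v) (ha : IsUnit a)
          (h : formCongr (conjLocal L (IsCMField.complexConj L) v) T (H.map (algebraMap L (UnitaryGroup.LocalRing L v))) =
            a • (Matrix.of fun i j : Fin 3 => if i.val + j.val + 1 = 3 then (1 : L) else 0).map (algebraMap L (UnitaryGroup.LocalRing L v))),
          ∃ (ε : (↥(maximalRealSubfield L))ˣ) (x₀ : IrrClass (Gqs L v)) (ψθ : ↥(normOneUnits (conjLocal L (IsCMField.complexConj L) v)) →* ℂˣ),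
            IsThetaCenterChar L μ χf ε v ψθ ∧
            x₀.IsConstituentOf (cmPrincipalSeries L 3 v (cmXiTorusChar L v ((toHeckeCharacter L μ).semilocalComponent L v) ψθ⁻¹ ψθ)) ∧
            ThetaTypeAtCM L H e₁ dV hdV hdV0 g hg μ hμ χf ε v (IrrClass.comap (cmDatumLocalCongr L v T ha h).symm x₀) := by
  intro L _ _ _ H hH hHd n' e₁ dV hdV hdV0 g hg μ hμ χf hcont hunit v hv T a ha h
  obtain ⟨ε, ψθ, hspec, ℓ, hℓ0, hℓ⟩ :=
    F0P2oK1aWOfLetters.stubK1aW_of_letters hN3 hU1 L H hH hHd e₁ dV hdV hdV0 g hg μ hμ χf hcont hunit v hv T a ha h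
  obtain ⟨hirr, hsm, hθ⟩ := F0P2oXThetaOwnClass.stubK1c_holds L H hH hHd e₁ dV hdV hdV0 g hg μ hμ χf hcont hunit v hv T a ha h ε
  refine ⟨ε, _, ψθ, hspec, ?_, hθ⟩
  exact F0P2oK1wOfWeylConj.stubK1w_of_weylConj hW L H hH hHd e₁ dV hdV hdV0 g hg μ hμ χf hcont hunit v hv T a ha h ψθ _
    (F0P2nFrobeniusFunctional.isConstituentOf_mk_cmPrincipalSeries_xi_of_functional L v _ ψθ⁻¹ ψθ _ hirr hsm ℓ hℓ hℓ0)

end Summit.HodgeConjecture.HodgeConjecture.Cruxes.H413.F0P2oThetaInPSOfLetters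

end
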